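import Summits.CriticalPhenomena.PercolationContinuityZ3.Theorems.PercNearOneGluingNoHeavyQuantLongTailQuadHubAlgK
import Summits.CriticalPhenomena.PercolationContinuityZ3.Theorems.PercNearOneGluingNoHeavyQuantLongTailTripleWide4Hub
import HarnessLib

/-!
# QUANT lane R8, T-DEC: THE LONG-TAIL QUAD HUB, ROUTE FILE — the routes of the low atoms `4lo`, `4lo+K` of the width-4 hub
# `S(γ₁) ∗ S(γ₂) ∗ S(γ₃) ∗ S(γ₄)` of shape `{lo, lo+K; γ}`, `2lo < K ≤ 4lo`, at ONE outer gate (census-1 gen 35)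

builds on p205010 (kernel theorem, internal audit signed; external expert review pending)

Support file (`--supports stmt-CriticalPhenomena-4575`), QUANT lane seat prim-quant-census-1 (gen 35); memo
`run/shared/lean/prim/quant/prim-quant-census-1/g35/QUADHUB-G35.md` §2.  Theorems only, standard axioms, no sorries.  Same architecture as gen 32/33's
`tripleHubLong_route` / `tripleWide4_routeOne/Two` for width 3, but SIMPLER: for width 4 on `2lo < K ≤ 4lo` NO nearest-first casework and no cost
branches are needed — the REFLECTED routes alone carry every instance (memo §1: exact census of 1.1 M (hub, floor, gate) instances, 0 failures):
`ν` the gated law with masses `a·u₀..a·u₄` at `4lo + sK`, `T = a(4lo + KΣγᵢ)` the gated mean, `y = ax` the gated floor, `D = T − 8lo`;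
* `quadHub_routeOne` — ONE low (`8lo < T ≤ 8lo+2K`): the atom `4lo` ships whole to `4lo+2K` when `D < K` (rate `max(y, D/2K)`: `quadHub_capAx`,
  `quadHub_capBK`) and to `4lo+3K` when `K ≤ D ≤ 2K` (rate `max(y, D/3K)`: `quadHub_capCK`, `quadHub_capDK`); the target is compatible
  (`T < 4lo + t`) and COST-SAFE (`y(t − 4lo) ≤ T − 4lo`, from `4y(lo+K) ≤ T` and `K ≤ 4lo`), so no torque bookkeeping is needed;
* `quadHub_routeTwo` — TWO lows (`T > 8lo+2K`, near-one gates): `4lo → 4lo+3K` (`quadHub_capCK/DK`) and `4lo+K → 4lo+2K` (rate `max(y, (D−2K)/K)`: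
  `quadHub_capEK/FK`); both targets lie below `T` (`4lo+3K ≤ 8lo+2K < T` as `K ≤ 4lo`).
The SDEC theorem is `…QuantLongTailQuadHub`.

HONEST STATUS.  Route bookkeeping; `SiblingStep`, `GluedDominatedMass`, `SDECConvClosed`, `FarTreeRow` OPEN; RATE class (log\*) / honest sentence of
`run/shared/lean/prim/quant/README.md` unchanged.  [this work].  Nothing here is cited as a published result.  The gluing rows served
[cite: KozmaNitzan2024, Conjecture 3 (p. 15)]; product measure [cite: Grimmett1999, §1.3 p. 10].
-/

noncomputable section
open scoped BigOperators

namespace Summit.CriticalPhenomena.PercolationContinuityZ3.Theorems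
namespace Quant
namespace LawDec

/-! ### A symmetry reduction -/

/-- the least of four reals, as a case split keeping the other three in their original order (symmetry reduction for the route lemmas).
[this work] -/
theorem exists_least_of_four (γ₁ γ₂ γ₃ γ₄ : ℝ) :
    ∃ p q r s : ℝ, ((p = γ₁ ∧ q = γ₂ ∧ r = γ₃ ∧ s = γ₄) ∨ (p = γ₂ ∧ q = γ₁ ∧ r = γ₃ ∧ s = γ₄) ∨
      (p = γ₃ ∧ q = γ₁ ∧ r = γ₂ ∧ s = γ₄) ∨ (p = γ₄ ∧ q = γ₁ ∧ r = γ₂ ∧ s = γ₃)) ∧ p ≤ q ∧ p ≤ r ∧ p ≤ s := by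
  by_cases h12 : γ₁ ≤ γ₂
  · by_cases h13 : γ₁ ≤ γ₃
    · by_cases h14 : γ₁ ≤ γ₄
      · exact ⟨γ₁, γ₂, γ₃, γ₄, Or.inl ⟨rfl, rfl, rfl, rfl⟩, h12, h13, h14⟩
      · push Not at h14
        exact ⟨γ₄, γ₁, γ₂, γ₃, Or.inr (Or.inr (Or.inr ⟨rfl, rfl, rfl, rfl⟩)), h14.le, le_trans h14.le h12, le_trans h14.le h13⟩
    · push Not at h13
      by_cases h34 : γ₃ ≤ γ₄
      · exact ⟨γ₃, γ₁, γ₂, γ₄, Or.inr (Or.inr (Or.inl ⟨rfl, rfl, rfl, rfl⟩)), h13.le, le_trans h13.le h12, h34⟩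
      · push Not at h34
        exact ⟨γ₄, γ₁, γ₂, γ₃, Or.inr (Or.inr (Or.inr ⟨rfl, rfl, rfl, rfl⟩)), le_trans h34.le h13.le,
          le_trans (le_trans h34.le h13.le) h12, h34.le⟩
  · push Not at h12
    by_cases h23 : γ₂ ≤ γ₃
    · by_cases h24 : γ₂ ≤ γ₄
      · exact ⟨γ₂, γ₁, γ₃, γ₄, Or.inr (Or.inl ⟨rfl, rfl, rfl, rfl⟩), h12.le, h23, h24⟩
      · push Not at h24
        exact ⟨γ₄, γ₁, γ₂, γ₃, Or.inr (Or.inr (Or.inr ⟨rfl, rfl, rfl, rfl⟩)), le_trans h24.le h12.le, h24.le, le_trans h24.le h23⟩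
    · push Not at h23
      by_cases h34 : γ₃ ≤ γ₄
      · exact ⟨γ₃, γ₁, γ₂, γ₄, Or.inr (Or.inr (Or.inl ⟨rfl, rfl, rfl, rfl⟩)), le_trans h23.le h12.le, h23.le, h34⟩
      · push Not at h34
        exact ⟨γ₄, γ₁, γ₂, γ₃, Or.inr (Or.inr (Or.inr ⟨rfl, rfl, rfl, rfl⟩)), le_trans (le_trans h34.le h23.le) h12.le,
          le_trans h34.le h23.le, h34.le⟩

/-! ### The routes of the long-tail quad hub at one outer gate -/

set_option maxHeartbeats 800000 in
/-- **the route of the quad hub at one outer gate, ONE low** (`ν` the gated law with masses `a·u₀..a·u₄` at `4lo + sK`, `y = ax` the gated floor,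
`T = a(4lo + K(g₁+g₂+g₃+g₄))` the gated mean with `8lo < T ≤ 8lo+2K`, `g₁` the least gate, `2lo < K ≤ 4lo`): the low atom `4lo` ships ENTIRELY to
`4lo+2K` when `T < 8lo+K` and to `4lo+3K` otherwise; the target is compatible, has the capacity at the layer-free rate, and is cost-safe
(`y·(t − 4lo) ≤ T − 4lo`). [this work] -/
theorem quadHub_routeOne (lo K : ℕ) (hloK : lo < K) (hK2 : 2 * lo < K) (hK8 : K ≤ 4 * lo) (ν : ℕ → ℝ) (y T a g₁ g₂ g₃ g₄ x : ℝ)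
    (g0 : ∀ h, 0 ≤ ν h) (h12 : g₁ ≤ g₂) (h13 : g₁ ≤ g₃) (h14 : g₁ ≤ g₄) (hg : (lo : ℝ) ≤ K * g₁) (h21 : g₂ < 1) (h31 : g₃ < 1) (h41 : g₄ < 1)
    (hx0 : 0 < x) (hxg : x * ((lo : ℝ) + K) ≤ lo + K * g₁) (ha0 : 0 < a) (ha1 : a ≤ 1) (hy : y = a * x)
    (hT : T = a * (4 * (lo : ℝ) + K * (g₁ + g₂ + g₃ + g₄))) (hT8 : 8 * (lo : ℝ) < T) (hT82 : T ≤ 8 * (lo : ℝ) + 2 * K)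
    (v0 : ν (4 * lo) = a * ((1 - g₁) * (1 - g₂) * (1 - g₃) * (1 - g₄)))
    (v2 : ν (4 * lo + 2 * K) = a * (g₁ * g₂ * (1 - g₃) * (1 - g₄) + g₁ * g₃ * (1 - g₂) * (1 - g₄) + g₁ * g₄ * (1 - g₂) * (1 - g₃)
          + g₂ * g₃ * (1 - g₁) * (1 - g₄) + g₂ * g₄ * (1 - g₁) * (1 - g₃) + g₃ * g₄ * (1 - g₁) * (1 - g₂)))
    (v3 : ν (4 * lo + 3 * K) = a * (g₂ * g₃ * g₄ * (1 - g₁) + g₁ * g₃ * g₄ * (1 - g₂) + g₁ * g₂ * g₄ * (1 - g₃) + g₁ * g₂ * g₃ * (1 - g₄))) :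
    ∃ t : ℕ, (t = 4 * lo + 2 * K ∨ t = 4 * lo + 3 * K) ∧ (T < ((4 * lo : ℕ) : ℝ) + (t : ℝ)) ∧
      freeRate y T (4 * lo) t * ν (4 * lo) ≤ ν t ∧ y * ((t : ℝ) - ((4 * lo : ℕ) : ℝ)) ≤ T - ((4 * lo : ℕ) : ℝ) := by
  have hlo1 : 1 ≤ lo := by omega
  have hlo0 : (0 : ℝ) < lo := by exact_mod_cast (show 0 < lo by omega)
  have hK2R : 2 * (lo : ℝ) ≤ K := by exact_mod_cast hK2.le
  have hK4R : (K : ℝ) ≤ 4 * lo := by exact_mod_cast hK8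
  have hK0 : (0 : ℝ) < K := by linarith
  have hg10 : 0 < g₁ := by
    by_contra hc; push Not at hc
    have : (K : ℝ) * g₁ ≤ 0 := mul_nonpos_of_nonneg_of_nonpos hK0.le hc
    linarith
  have hg11 : g₁ < 1 := lt_of_le_of_lt h12 h21
  have hg₂K : (lo : ℝ) ≤ K * g₂ := le_trans hg (mul_le_mul_of_nonneg_left h12 hK0.le)
  have hg₃K : (lo : ℝ) ≤ K * g₃ := le_trans hg (mul_le_mul_of_nonneg_left h13 hK0.le)
  have hg₄K : (lo : ℝ) ≤ K * g₄ := le_trans hg (mul_le_mul_of_nonneg_left h14 hK0.le)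
  obtain ⟨hu0n, hu1n, hu2n, hu3n⟩ := quadHub_masses_nonneg g₁ g₂ g₃ g₄ hg10.le (by linarith) (by linarith) (by linarith) hg11.le h21.le h31.le h41.le
  set u0 : ℝ := (1 - g₁) * (1 - g₂) * (1 - g₃) * (1 - g₄) with hu0
  set u2 : ℝ := g₁ * g₂ * (1 - g₃) * (1 - g₄) + g₁ * g₃ * (1 - g₂) * (1 - g₄) + g₁ * g₄ * (1 - g₂) * (1 - g₃)
          + g₂ * g₃ * (1 - g₁) * (1 - g₄) + g₂ * g₄ * (1 - g₁) * (1 - g₃) + g₃ * g₄ * (1 - g₁) * (1 - g₂) with hu2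
  set u3 : ℝ := g₂ * g₃ * g₄ * (1 - g₁) + g₁ * g₃ * g₄ * (1 - g₂) + g₁ * g₂ * g₄ * (1 - g₃) + g₁ * g₂ * g₃ * (1 - g₄) with hu3
  set T₀ : ℝ := 4 * (lo : ℝ) + K * (g₁ + g₂ + g₃ + g₄) with hT₀
  have hT0p : 0 < T₀ := by
    have := mul_pos hK0 (by linarith : 0 < g₁ + g₂ + g₃ + g₄); rw [hT₀]; linarith
  have hTle : T ≤ T₀ := by
    have := mul_le_mul_of_nonneg_right ha1 hT0p.le; rw [hT]; linarith
  have hx1 : x < 1 := by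
    have : (lo : ℝ) + K * g₁ < lo + K := by have := mul_lt_mul_of_pos_left hg11 hK0; linarith
    by_contra hc; push Not at hc
    have : 1 * ((lo : ℝ) + K) ≤ x * (lo + K) := mul_le_mul_of_nonneg_right hc (by linarith)
    linarith
  have hyx : y ≤ x := by rw [hy]; have := mul_le_mul_of_nonneg_right ha1 hx0.le; linarith
  have hy0 : 0 < y := by rw [hy]; exact mul_pos ha0 hx0
  have hy1 : y < 1 := lt_of_le_of_lt hyx hx1
  -- the crude floor bound `4y(lo+K) ≤ T`
  have hy4 : 4 * y * ((lo : ℝ) + K) ≤ T := by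
    have h1 : 4 * (x * ((lo : ℝ) + K)) ≤ T₀ := by
      have : (K : ℝ) * (4 * g₁) ≤ K * (g₁ + g₂ + g₃ + g₄) := mul_le_mul_of_nonneg_left (by linarith) hK0.le
      rw [hT₀]; linarith
    have h2 := mul_le_mul_of_nonneg_left h1 ha0.le
    rw [hy, hT]; linarith
  -- floor capacity of `4lo → 4lo+2K`
  have hxA : x * (u0 + u2) ≤ u2 := by
    have h := quadHub_capAx (lo : ℝ) K g₁ g₂ g₃ g₄ x hlo0 hK2R hK4R hg h12 h13 h14 h21.le h31.le h41.le hxg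
    rw [← hu0, ← hu2] at h; exact h
  clear_value u0 u2 u3 T₀
  set D : ℝ := T - 8 * (lo : ℝ) with hD
  have hDp : 0 < D := by rw [hD]; linarith
  have hDle : D ≤ K * (g₁ + g₂ + g₃ + g₄) - 4 * lo := by have h := hTle; rw [hT₀] at h; rw [hD]; linarith
  have hD2K : D ≤ 2 * K := by rw [hD]; linarith
  have c4lo : ((4 * lo : ℕ) : ℝ) = 4 * (lo : ℝ) := by push_cast; ring
  by_cases hDK : D < K
  · -- FIRST branch: all of `4lo` to `4lo + 2K`, rate `max(y, D/(2K))`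
    refine ⟨4 * lo + 2 * K, Or.inl rfl, by push_cast; linarith, ?_, ?_⟩
    · have ed : (((4 * lo + 2 * K : ℕ) : ℝ) - ((4 * lo : ℕ) : ℝ)) = 2 * K := by push_cast; ring
      have eD : T - 2 * (((4 * lo : ℕ) : ℝ)) = D := by rw [c4lo, hD]; ring
      have eθ : freeRate y T (4 * lo) (4 * lo + 2 * K) = max y (D / (2 * K)) / (1 - max y (D / (2 * K))) := by
        unfold freeRate; rw [ed, eD]
      have hK20 : (0 : ℝ) < 2 * K := by linarith
      have hρ1 : D / (2 * K) < 1 := by rw [div_lt_one hK20]; linarith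
      have hθlt : max y (D / (2 * K)) < 1 := max_lt hy1 hρ1
      rw [eθ]
      refine rate_mul_le_of_theta hθlt ?_ (g0 _)
      rw [v0, v2, show a * u0 + a * u2 = a * (u0 + u2) by ring, max_mul_of_nonneg _ _ (mul_nonneg ha0.le (add_nonneg hu0n hu2n))]
      refine max_le ?_ ?_
      · have h1 : y * (u0 + u2) ≤ x * (u0 + u2) := mul_le_mul_of_nonneg_right hyx (add_nonneg hu0n hu2n)
        have h2 : a * (y * (u0 + u2)) ≤ a * u2 := mul_le_mul_of_nonneg_left (le_trans h1 hxA) ha0.le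
        linarith
      · -- `D(u₀+u₂) ≤ 2K·u₂` (`quadHub_capBK`)
        have hB := quadHub_capBK (lo : ℝ) K g₁ g₂ g₃ g₄ D hlo0 hK2R hK4R hg hg₂K hg₃K hg₄K hg11.le h21.le h31.le h41.le hDp.le hDK.le hDle
        rw [← hu0, ← hu2] at hB
        rw [div_mul_eq_mul_div, div_le_iff₀ hK20]
        have h3 : a * (D * (u0 + u2)) ≤ a * (2 * K * u2) := mul_le_mul_of_nonneg_left (by linarith) ha0.le
        linarith
    · -- cost-safe: `2yK ≤ 2y(lo+K) ≤ T/2 ≤ T − 4lo`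
      push_cast
      have : 0 ≤ y * (lo : ℝ) := mul_nonneg hy0.le hlo0.le
      linarith
  · -- SECOND branch: all of `4lo` to `4lo + 3K`, rate `max(y, D/(3K))`
    push Not at hDK
    refine ⟨4 * lo + 3 * K, Or.inr rfl, by push_cast; linarith, ?_, ?_⟩
    · have ed : (((4 * lo + 3 * K : ℕ) : ℝ) - ((4 * lo : ℕ) : ℝ)) = 3 * K := by push_cast; ring
      have eD : T - 2 * (((4 * lo : ℕ) : ℝ)) = D := by rw [c4lo, hD]; ring
      have eθ : freeRate y T (4 * lo) (4 * lo + 3 * K) = max y (D / (3 * K)) / (1 - max y (D / (3 * K))) := by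
        unfold freeRate; rw [ed, eD]
      have hK30 : (0 : ℝ) < 3 * K := by linarith
      have hρ1 : D / (3 * K) < 1 := by rw [div_lt_one hK30]; linarith
      have hθlt : max y (D / (3 * K)) < 1 := max_lt hy1 hρ1
      rw [eθ]
      refine rate_mul_le_of_theta hθlt ?_ (g0 _)
      rw [v0, v3, show a * u0 + a * u3 = a * (u0 + u3) by ring, max_mul_of_nonneg _ _ (mul_nonneg ha0.le (add_nonneg hu0n hu3n))]
      refine max_le ?_ ?_
      · -- `(D+8lo)(u₀+u₃) ≤ 4(lo+K)u₃` (`quadHub_capCK`) and `4y(lo+K) ≤ T = D + 8lo`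
        have hC := quadHub_capCK (lo : ℝ) K g₁ g₂ g₃ g₄ D hlo0 hK2R hK4R hg hg₂K hg₃K hg₄K hg11.le h21.le h31.le h41.le hDK hDle
        rw [← hu0, ← hu3] at hC
        have hB0 : (0 : ℝ) < 4 * ((lo : ℝ) + K) := by linarith
        have h1 : 4 * ((lo : ℝ) + K) * (y * (u0 + u3)) ≤ (D + 8 * lo) * (u0 + u3) := by
          have := mul_le_mul_of_nonneg_right hy4 (add_nonneg hu0n hu3n); rw [hD]; linarith
        have h2 : 4 * ((lo : ℝ) + K) * (y * (u0 + u3)) ≤ 4 * ((lo : ℝ) + K) * u3 := by linarith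
        have h3 := le_of_mul_le_mul_left h2 hB0
        have h4 : a * (y * (u0 + u3)) ≤ a * u3 := mul_le_mul_of_nonneg_left h3 ha0.le
        linarith
      · -- `D(u₀+u₃) ≤ 3K·u₃` (`quadHub_capDK`)
        have hDc := quadHub_capDK (lo : ℝ) K g₁ g₂ g₃ g₄ D hlo0 hK2R hK4R hg hg₂K hg₃K hg₄K hg11.le h21.le h31.le h41.le hDK hDle
        rw [← hu0, ← hu3] at hDc
        rw [div_mul_eq_mul_div, div_le_iff₀ hK30]
        have h3 : a * (D * (u0 + u3)) ≤ a * (3 * K * u3) := mul_le_mul_of_nonneg_left (by linarith) ha0.le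
        linarith
    · -- cost-safe: `3yK·4(lo+K) ≤ 3KT ≤ 4(lo+K)(T − 4lo)` since `T ≥ 8lo+K`, `K ≤ 4lo`
      push_cast
      have hB0 : (0 : ℝ) < 4 * ((lo : ℝ) + K) := by linarith
      have hT8K : 8 * (lo : ℝ) + K ≤ T := by rw [hD] at hDK; linarith
      have h1 : 4 * ((lo : ℝ) + K) * (y * (3 * K)) ≤ 3 * K * T := by
        have := mul_le_mul_of_nonneg_right hy4 (show (0 : ℝ) ≤ 3 * K by linarith); linarith
      have h2 : 3 * (K : ℝ) * T ≤ 4 * ((lo : ℝ) + K) * (T - 4 * lo) := by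
        nlinarith [mul_nonneg (sub_nonneg.2 hK4R) hlo0.le, mul_nonneg (sub_nonneg.2 hT8K) hlo0.le,
          mul_nonneg (sub_nonneg.2 hT8K) hK0.le]
      have h3 : 4 * ((lo : ℝ) + K) * (y * (3 * K)) ≤ 4 * ((lo : ℝ) + K) * (T - 4 * lo) := le_trans h1 h2
      have h4 := le_of_mul_le_mul_left h3 hB0
      linarith

set_option maxHeartbeats 800000 in
/-- **the routes of the quad hub at one outer gate, TWO lows** (`8lo + 2K < T`: the atoms `4lo` and `4lo+K` are both below `T/2`): `4lo` ships to
`4lo+3K` and `4lo+K` to `4lo+2K` (different columns, both targets below `T` since `K ≤ 4lo`); the two capacities at the layer-free rates. [this work] -/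
theorem quadHub_routeTwo (lo K : ℕ) (hloK : lo < K) (hK2 : 2 * lo < K) (hK8 : K ≤ 4 * lo) (ν : ℕ → ℝ) (y T a g₁ g₂ g₃ g₄ x : ℝ)
    (g0 : ∀ h, 0 ≤ ν h) (h12 : g₁ ≤ g₂) (h13 : g₁ ≤ g₃) (h14 : g₁ ≤ g₄) (hg : (lo : ℝ) ≤ K * g₁) (h21 : g₂ < 1) (h31 : g₃ < 1) (h41 : g₄ < 1)
    (hx0 : 0 < x) (hxg : x * ((lo : ℝ) + K) ≤ lo + K * g₁) (ha0 : 0 < a) (ha1 : a ≤ 1) (hy : y = a * x)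
    (hT : T = a * (4 * (lo : ℝ) + K * (g₁ + g₂ + g₃ + g₄))) (hT82 : 8 * (lo : ℝ) + 2 * K < T)
    (v0 : ν (4 * lo) = a * ((1 - g₁) * (1 - g₂) * (1 - g₃) * (1 - g₄)))
    (v1 : ν (4 * lo + K) = a * (g₁ * (1 - g₂) * (1 - g₃) * (1 - g₄) + g₂ * (1 - g₁) * (1 - g₃) * (1 - g₄)
        + g₃ * (1 - g₁) * (1 - g₂) * (1 - g₄) + g₄ * (1 - g₁) * (1 - g₂) * (1 - g₃)))
    (v2 : ν (4 * lo + 2 * K) = a * (g₁ * g₂ * (1 - g₃) * (1 - g₄) + g₁ * g₃ * (1 - g₂) * (1 - g₄) + g₁ * g₄ * (1 - g₂) * (1 - g₃)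
          + g₂ * g₃ * (1 - g₁) * (1 - g₄) + g₂ * g₄ * (1 - g₁) * (1 - g₃) + g₃ * g₄ * (1 - g₁) * (1 - g₂)))
    (v3 : ν (4 * lo + 3 * K) = a * (g₂ * g₃ * g₄ * (1 - g₁) + g₁ * g₃ * g₄ * (1 - g₂) + g₁ * g₂ * g₄ * (1 - g₃) + g₁ * g₂ * g₃ * (1 - g₄))) :
    freeRate y T (4 * lo) (4 * lo + 3 * K) * ν (4 * lo) ≤ ν (4 * lo + 3 * K) ∧
      freeRate y T (4 * lo + K) (4 * lo + 2 * K) * ν (4 * lo + K) ≤ ν (4 * lo + 2 * K) := by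
  have hlo1 : 1 ≤ lo := by omega
  have hlo0 : (0 : ℝ) < lo := by exact_mod_cast (show 0 < lo by omega)
  have hK2R : 2 * (lo : ℝ) ≤ K := by exact_mod_cast hK2.le
  have hK4R : (K : ℝ) ≤ 4 * lo := by exact_mod_cast hK8
  have hK0 : (0 : ℝ) < K := by linarith
  have hg10 : 0 < g₁ := by
    by_contra hc; push Not at hc
    have : (K : ℝ) * g₁ ≤ 0 := mul_nonpos_of_nonneg_of_nonpos hK0.le hc
    linarith
  have hg11 : g₁ < 1 := lt_of_le_of_lt h12 h21
  have hg₂K : (lo : ℝ) ≤ K * g₂ := le_trans hg (mul_le_mul_of_nonneg_left h12 hK0.le)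
  have hg₃K : (lo : ℝ) ≤ K * g₃ := le_trans hg (mul_le_mul_of_nonneg_left h13 hK0.le)
  have hg₄K : (lo : ℝ) ≤ K * g₄ := le_trans hg (mul_le_mul_of_nonneg_left h14 hK0.le)
  obtain ⟨hu0n, hu1n, hu2n, hu3n⟩ := quadHub_masses_nonneg g₁ g₂ g₃ g₄ hg10.le (by linarith) (by linarith) (by linarith) hg11.le h21.le h31.le h41.le
  set u0 : ℝ := (1 - g₁) * (1 - g₂) * (1 - g₃) * (1 - g₄) with hu0
  set u1 : ℝ := g₁ * (1 - g₂) * (1 - g₃) * (1 - g₄) + g₂ * (1 - g₁) * (1 - g₃) * (1 - g₄)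
        + g₃ * (1 - g₁) * (1 - g₂) * (1 - g₄) + g₄ * (1 - g₁) * (1 - g₂) * (1 - g₃) with hu1
  set u2 : ℝ := g₁ * g₂ * (1 - g₃) * (1 - g₄) + g₁ * g₃ * (1 - g₂) * (1 - g₄) + g₁ * g₄ * (1 - g₂) * (1 - g₃)
          + g₂ * g₃ * (1 - g₁) * (1 - g₄) + g₂ * g₄ * (1 - g₁) * (1 - g₃) + g₃ * g₄ * (1 - g₁) * (1 - g₂) with hu2
  set u3 : ℝ := g₂ * g₃ * g₄ * (1 - g₁) + g₁ * g₃ * g₄ * (1 - g₂) + g₁ * g₂ * g₄ * (1 - g₃) + g₁ * g₂ * g₃ * (1 - g₄) with hu3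
  set T₀ : ℝ := 4 * (lo : ℝ) + K * (g₁ + g₂ + g₃ + g₄) with hT₀
  have hT0p : 0 < T₀ := by
    have := mul_pos hK0 (by linarith : 0 < g₁ + g₂ + g₃ + g₄); rw [hT₀]; linarith
  have hTle : T ≤ T₀ := by
    have := mul_le_mul_of_nonneg_right ha1 hT0p.le; rw [hT]; linarith
  have hT0top : T₀ < 4 * (lo : ℝ) + 4 * K := by
    have := mul_lt_mul_of_pos_left (by linarith : g₁ + g₂ + g₃ + g₄ < 4) hK0; rw [hT₀]; linarith
  have hx1 : x < 1 := by
    have : (lo : ℝ) + K * g₁ < lo + K := by have := mul_lt_mul_of_pos_left hg11 hK0; linarith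
    by_contra hc; push Not at hc
    have : 1 * ((lo : ℝ) + K) ≤ x * (lo + K) := mul_le_mul_of_nonneg_right hc (by linarith)
    linarith
  have hyx : y ≤ x := by rw [hy]; have := mul_le_mul_of_nonneg_right ha1 hx0.le; linarith
  have hy0 : 0 < y := by rw [hy]; exact mul_pos ha0 hx0
  have hy1 : y < 1 := lt_of_le_of_lt hyx hx1
  have hy4 : 4 * y * ((lo : ℝ) + K) ≤ T := by
    have h1 : 4 * (x * ((lo : ℝ) + K)) ≤ T₀ := by
      have : (K : ℝ) * (4 * g₁) ≤ K * (g₁ + g₂ + g₃ + g₄) := mul_le_mul_of_nonneg_left (by linarith) hK0.le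
      rw [hT₀]; linarith
    have h2 := mul_le_mul_of_nonneg_left h1 ha0.le
    rw [hy, hT]; linarith
  clear_value u0 u1 u2 u3 T₀
  set D : ℝ := T - 8 * (lo : ℝ) with hD
  have hD2 : 2 * (K : ℝ) < D := by rw [hD]; linarith
  have hDK : (K : ℝ) ≤ D := by linarith
  have hDle : D ≤ K * (g₁ + g₂ + g₃ + g₄) - 4 * lo := by have h := hTle; rw [hT₀] at h; rw [hD]; linarith
  have hD3 : D < 3 * K := by rw [hD]; linarith
  clear_value D
  have c4lo : ((4 * lo : ℕ) : ℝ) = 4 * (lo : ℝ) := by push_cast; ring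
  have cA1 : ((4 * lo + K : ℕ) : ℝ) = 4 * (lo : ℝ) + K := by push_cast; ring
  have hB0 : (0 : ℝ) < 4 * ((lo : ℝ) + K) := by linarith
  refine ⟨?_, ?_⟩
  · -- `4lo → 4lo+3K`, rate `max(y, D/(3K))`
    have ed : (((4 * lo + 3 * K : ℕ) : ℝ) - ((4 * lo : ℕ) : ℝ)) = 3 * K := by push_cast; ring
    have eD : T - 2 * (((4 * lo : ℕ) : ℝ)) = D := by rw [c4lo, hD]; ring
    have eθ : freeRate y T (4 * lo) (4 * lo + 3 * K) = max y (D / (3 * K)) / (1 - max y (D / (3 * K))) := by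
      unfold freeRate; rw [ed, eD]
    have hK30 : (0 : ℝ) < 3 * K := by linarith
    have hρ1 : D / (3 * K) < 1 := by rw [div_lt_one hK30]; linarith
    have hθlt : max y (D / (3 * K)) < 1 := max_lt hy1 hρ1
    rw [eθ]
    refine rate_mul_le_of_theta hθlt ?_ (g0 _)
    rw [v0, v3, show a * u0 + a * u3 = a * (u0 + u3) by ring, max_mul_of_nonneg _ _ (mul_nonneg ha0.le (add_nonneg hu0n hu3n))]
    refine max_le ?_ ?_
    · have hC := quadHub_capCK (lo : ℝ) K g₁ g₂ g₃ g₄ D hlo0 hK2R hK4R hg hg₂K hg₃K hg₄K hg11.le h21.le h31.le h41.le hDK hDle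
      rw [← hu0, ← hu3] at hC
      have h1 : 4 * ((lo : ℝ) + K) * (y * (u0 + u3)) ≤ (D + 8 * lo) * (u0 + u3) := by
        have := mul_le_mul_of_nonneg_right hy4 (add_nonneg hu0n hu3n); rw [hD]; linarith
      have h3 := le_of_mul_le_mul_left (h1.trans hC) hB0
      have h4 : a * (y * (u0 + u3)) ≤ a * u3 := mul_le_mul_of_nonneg_left h3 ha0.le
      linarith
    · have hDc := quadHub_capDK (lo : ℝ) K g₁ g₂ g₃ g₄ D hlo0 hK2R hK4R hg hg₂K hg₃K hg₄K hg11.le h21.le h31.le h41.le hDK hDle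
      rw [← hu0, ← hu3] at hDc
      rw [div_mul_eq_mul_div, div_le_iff₀ hK30]
      have h3 : a * (D * (u0 + u3)) ≤ a * (3 * K * u3) := mul_le_mul_of_nonneg_left (by linarith) ha0.le
      linarith
  · -- `4lo+K → 4lo+2K`, rate `max(y, (D−2K)/K)`
    have ed : (((4 * lo + 2 * K : ℕ) : ℝ) - ((4 * lo + K : ℕ) : ℝ)) = K := by push_cast; ring
    have eD : T - 2 * (((4 * lo + K : ℕ) : ℝ)) = D - 2 * K := by rw [cA1, hD]; ring
    have eθ : freeRate y T (4 * lo + K) (4 * lo + 2 * K) = max y ((D - 2 * K) / K) / (1 - max y ((D - 2 * K) / K)) := by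
      unfold freeRate; rw [ed, eD]
    have hρ1 : (D - 2 * K) / K < 1 := by rw [div_lt_one hK0]; linarith
    have hθlt : max y ((D - 2 * K) / K) < 1 := max_lt hy1 hρ1
    rw [eθ]
    refine rate_mul_le_of_theta hθlt ?_ (g0 _)
    rw [v1, v2, show a * u1 + a * u2 = a * (u1 + u2) by ring, max_mul_of_nonneg _ _ (mul_nonneg ha0.le (add_nonneg hu1n hu2n))]
    refine max_le ?_ ?_
    · have hE := quadHub_capEK (lo : ℝ) K g₁ g₂ g₃ g₄ D hlo0 hK2R hK4R hg hg₂K hg₃K hg₄K hg11.le h21.le h31.le h41.le hD2.le hDle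
      rw [← hu1, ← hu2] at hE
      have h1 : 4 * ((lo : ℝ) + K) * (y * (u1 + u2)) ≤ (D + 8 * lo) * (u1 + u2) := by
        have := mul_le_mul_of_nonneg_right hy4 (add_nonneg hu1n hu2n); rw [hD]; linarith
      have h3 := le_of_mul_le_mul_left (h1.trans hE) hB0
      have h4 : a * (y * (u1 + u2)) ≤ a * u2 := mul_le_mul_of_nonneg_left h3 ha0.le
      linarith
    · have hF := quadHub_capFK (lo : ℝ) K g₁ g₂ g₃ g₄ D hlo0 hK2R hK4R hg hg₂K hg₃K hg₄K hg11.le h21.le h31.le h41.le hD2.le hDle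
      rw [← hu1, ← hu2] at hF
      rw [div_mul_eq_mul_div, div_le_iff₀ hK0]
      have h3 : a * ((D - 2 * K) * (u1 + u2)) ≤ a * (K * u2) := mul_le_mul_of_nonneg_left (by linarith) ha0.le
      linarith

end LawDec
end Quant
end Summit.CriticalPhenomena.PercolationContinuityZ3.Theorems
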